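import Literature.RingTheory.Flat.NilpotentCriterion
import Mathlib.RingTheory.Filtration
import Mathlib.LinearAlgebra.TensorProduct.Pi
import Mathlib.RingTheory.LocalRing.RingHom.Basic
import Mathlib.LinearAlgebra.Basis.VectorSpace
import HarnessLib

/-!
# The local flatness criterion (Matsumura, Thm. 22.3 (β); Stacks 00MK)

Matsumura, *Commutative Ring Theory*, Thm. 22.3: for a ring `A`, an ideal `I` and an `A`-module
`M`, `A₀ = A/I`, `M₀ = M/IM`, "suppose that … (β) `A` is a Noetherian ring and `M` is `I`-adically
ideal-separated [i.e. `𝔞 ⊗ M` is separated for the `I`-adic topology for every ideal `𝔞` of `A`].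
Then the following conditions are equivalent. (1) `M` is flat over `A`; … (3) `M₀` is flat over
`A₀` and `I ⊗_A M = IM` [`Tor₁^A(A₀, M) = 0`]; …". The remark preceding it: if `B` is a
Noetherian `A`-algebra with `IB ⊆ rad(B)` and `M` a finite `B`-module, then `M` is `I`-adically
ideal-separated (`𝔞 ⊗_A M` is a finite `B`-module; Krull's intersection theorem). The Stacks
Project, Tag 00MK ("Let `R → S` be a local homomorphism of local Noetherian rings. Let `𝔪` be the
maximal ideal of `R`, and let `κ = R/𝔪`. Let `M` be a finite `S`-module. If `Tor₁^R(κ, M) = 0`,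
then `M` is flat over `R`.") is the case `I = 𝔪`, `A → B` local.

This file PROVES (3) ⇒ (1) under (β), on top of the elementary `Tor₁` toolkit of this directory
(`TorOneVanishing.lean`, `NilpotentCriterion.lean`; `Tor₁ = 0` is the predicate `TorOneVanishes`,
"`M₀` flat over `A₀`" is tested on ideals `𝔠̄ ⊆ A/I` as there):

* `torOneVanishes_of_pow_smul_eq_zero` — (3) ⇒ `Tor₁^A(Q, M) = 0` for every FINITE `A`-module `Q`
  killed by a power of `I` (The Stacks Project, Tag 051C (2); the inductive step of Matsumura's
  proof, `0 → IQ → Q → Q/IQ → 0`);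
* `flat_of_iInf_pow_smul_eq_bot` — **Thm. 22.3 (β), (3) ⇒ (1)** for `A` Noetherian and `M`
  `I`-adically ideal-separated (`⋂ₖ Iᵏ(M ⊗ 𝔞) = 0` for all ideals `𝔞`): for `x` in the kernel of
  `M ⊗ 𝔞 → M`, the image of `x` in `M ⊗ (𝔞 + Iⁿ)/Iⁿ ↪ M ⊗ A/Iⁿ` (injective: the cokernel
  `A/(𝔞 + Iⁿ)` is finite and killed by `Iⁿ`) vanishes, so `x` comes from `M ⊗ (𝔞 ∩ Iⁿ)`, and
  `𝔞 ∩ Iⁿ ⊆ Iⁿ⁻ᶜ𝔞` (Artin–Rees, Mathlib `Ideal.exists_pow_inf_eq_pow_smul`) puts `x` in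
  `Iⁿ⁻ᶜ(M ⊗ 𝔞)` for all `n`, hence `x = 0`;
* `finite_tensorProduct_of_finite` — `M ⊗_A Q` is a finite `B`-module for `M` finite over `B` and
  `Q` finite over `A`;
* `flat_of_le_jacobson` — **Thm. 22.3 (β), (3) ⇒ (1)** for a finite module over a Noetherian
  `A`-algebra `B` with `IB ⊆ rad B` (Krull, Mathlib `Ideal.iInf_pow_smul_eq_bot_of_le_jacobson`);
* `flat_of_injective_lTensor_maximalIdeal` — **the local criterion, Stacks 00MK**.

## References

* H. Matsumura, *Commutative Ring Theory*, CSAM 8 (1986), §22, Thm. 22.3 and the remark before it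
  (book pp. 173–176); Thm. 8.5 (Artin–Rees), Thm. 8.10 (Krull). [Matsumura1987]
* The Stacks Project, Tags 00MK, 051C, 00HL. [StacksProject]
-/

universe u v w

open TensorProduct

namespace Literature.RingTheory.Flat

variable {R : Type u} [CommRing R] {N : Type v} [AddCommGroup N] [Module R N]

/-! ### `Tor₁` vanishes on finite modules killed by a power of the ideal -/

/-- **`Tor₁(Q, N) = 0` for finite `Q` killed by `Jᵏ`** (The Stacks Project, Tag 051C (2), for
finite modules): if `J` is finitely generated, `N ⊗ J → N ⊗ R` is injective (`Tor₁(R/J, N) = 0`)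
and `N/JN` is `R/J`-flat (tested on ideals `𝔠̄ ⊆ R/J`), then `Tor₁(Q, N) = 0` for every finitely
generated `R`-module `Q` with `JᵏQ = 0` — induction on `k` through `0 → JQ → Q → Q/JQ → 0`
(`TorOneVanishes.extension`), the case `k = 1` being `torOneVanishes_of_span_eq_top_of_smul_eq_zero`.
[cite: StacksProject, Tag 051C (2)] -/
theorem torOneVanishes_of_pow_smul_eq_zero {J : Ideal R} (hJfg : J.FG)
    (hi : Function.Injective (LinearMap.lTensor N J.subtype))
    (hii : ∀ 𝔠' : Ideal (R ⧸ J),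
      Function.Injective (LinearMap.lTensor N (𝔠'.subtype.restrictScalars R))) (k : ℕ) :
    ∀ (Q : Type u) [AddCommGroup Q] [Module R Q] [Module.Finite R Q],
      (∀ j ∈ J ^ k, ∀ q : Q, j • q = 0) → TorOneVanishes R N Q := by
  classical
  induction k with
  | zero =>
    intro Q _ _ _ h
    haveI : Subsingleton Q := subsingleton_of_forall_eq 0 fun q => by
      simpa using h 1 (by rw [pow_zero, Ideal.one_eq_top]; exact Submodule.mem_top) q
    exact TorOneVanishes.of_subsingleton
  | succ k ih =>
    intro Q _ _ _ h
    let Q' : Submodule R Q := J • ⊤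
    -- `JQ` is finitely generated and killed by `J ^ k`
    haveI : Module.Finite R ↥Q' :=
      Module.Finite.iff_fg.mpr (Submodule.FG.smul hJfg Module.Finite.fg_top)
    have hle : J ^ (k + 1) • (⊤ : Submodule R Q) ≤ ⊥ :=
      Submodule.smul_le.mpr fun j hj q _ => (Submodule.mem_bot R).mpr (h j hj q)
    have h' : TorOneVanishes R N ↥Q' := by
      refine ih (↥Q') fun j hj x => Subtype.ext ?_
      change j • (x : Q) = 0
      have hx : j • (x : Q) ∈ J ^ (k + 1) • (⊤ : Submodule R Q) := by
        rw [pow_succ, Submodule.mul_smul]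
        exact Submodule.smul_mem_smul hj x.2
      exact (Submodule.mem_bot R).mp (hle hx)
    -- `Q/JQ` is finitely generated and killed by `J`
    have h'' : TorOneVanishes R N (Q ⧸ Q') := by
      obtain ⟨s, hs⟩ := Module.Finite.fg_top (R := R) (M := Q ⧸ Q')
      refine torOneVanishes_of_span_eq_top_of_smul_eq_zero hi hii s.card (Q ⧸ Q')
        ⟨s, le_rfl, hs⟩ ?_
      intro j hj q
      obtain ⟨q, rfl⟩ := Q'.mkQ_surjective q
      rw [← map_smul, Submodule.mkQ_apply, Submodule.Quotient.mk_eq_zero]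
      exact Submodule.smul_mem_smul hj Submodule.mem_top
    exact TorOneVanishes.extension (LinearMap.exact_subtype_mkQ Q')
      (Submodule.injective_subtype _) (Submodule.mkQ_surjective Q') h' h''

/-! ### Matsumura, Thm. 22.3 (β): (3) ⇒ (1) for ideal-separated modules -/

/-- **Matsumura, Thm. 22.3 under (β), (3) ⇒ (1), ideal-separated form.** Let `A` be Noetherian,
`J` an ideal and `N` an `A`-module which is `J`-adically ideal-separated: `⋂ₖ Jᵏ(N ⊗ 𝔞) = 0` for
every ideal `𝔞`. If `N ⊗ J → N ⊗ A` is injective (`J ⊗ N = JN`) and `N/JN` is flat over `A/J`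
(tested on ideals of `A/J`), then `N` is flat over `A`. Printed proof ((5) ⇒ (1)): for `x` in the
kernel of `N ⊗ 𝔞 → N`, its image in `N ⊗ (𝔞 + Jⁿ)/Jⁿ` vanishes because
`N ⊗ (𝔞 + Jⁿ)/Jⁿ → N ⊗ A/Jⁿ` is injective (here: its cokernel is finite and killed by `Jⁿ`,
`torOneVanishes_of_pow_smul_eq_zero`), so `x` comes from `N ⊗ (𝔞 ∩ Jⁿ) ⊆ Jⁿ⁻ᶜ(N ⊗ 𝔞)` by
Artin–Rees; hence `x ∈ ⋂ₖ Jᵏ(N ⊗ 𝔞) = 0`. [cite: Matsumura1987, §22 Thm. 22.3 (β), (3) ⇒ (1)] -/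
theorem flat_of_iInf_pow_smul_eq_bot [IsNoetherianRing R] (J : Ideal R)
    (hsep : ∀ I : Ideal R, (⨅ k : ℕ, J ^ k • ⊤ : Submodule R (N ⊗[R] ↥I)) = ⊥)
    (hi : Function.Injective (LinearMap.lTensor N J.subtype))
    (hii : ∀ 𝔠' : Ideal (R ⧸ J),
      Function.Injective (LinearMap.lTensor N (𝔠'.subtype.restrictScalars R))) :
    Module.Flat R N := by
  classical
  have hJfg : J.FG := IsNoetherian.noetherian J
  rw [Module.Flat.iff_lTensor_injective']
  intro I
  rw [← LinearMap.ker_eq_bot, Submodule.eq_bot_iff]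
  intro x hx
  rw [LinearMap.mem_ker] at hx
  -- Artin–Rees for `I ⊆ A` and the `J`-adic filtration
  obtain ⟨c, hc⟩ := Ideal.exists_pow_inf_eq_pow_smul J (I : Submodule R R)
  have hAR : ∀ k : ℕ, ∀ a : R, a ∈ I → a ∈ J ^ (k + c) → a ∈ J ^ k • I := by
    intro k a haI haJ
    have h1 : a ∈ J ^ (k + c) • (⊤ : Submodule R R) ⊓ I := by
      refine ⟨?_, haI⟩
      rw [Ideal.smul_eq_mul, Ideal.mul_top]
      exact haJ
    rw [hc (k + c) (Nat.le_add_left c k), Nat.add_sub_cancel] at h1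
    exact Submodule.smul_mono le_rfl inf_le_right h1
  -- `x ∈ Jᵏ (N ⊗ I)` for every `k`
  have hmem : ∀ k : ℕ, x ∈ (J ^ k • ⊤ : Submodule R (N ⊗[R] ↥I)) := by
    intro k
    let Jn : Ideal R := J ^ (k + c)
    -- the image `Ī = (I + Jⁿ)/Jⁿ` of `I` in `A/Jⁿ`, `n = k + c`
    let mk : R →ₗ[R] R ⧸ Jn := (Ideal.Quotient.mkₐ R Jn).toLinearMap
    let Ibar : Submodule R (R ⧸ Jn) := (I.map (Ideal.Quotient.mk Jn)).restrictScalars R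
    let ρ : ↥I →ₗ[R] ↥Ibar :=
      (mk ∘ₗ I.subtype).codRestrict _ fun a => Ideal.mem_map_of_mem (Ideal.Quotient.mk Jn) a.2
    let ι : ↥(I ⊓ Jn) →ₗ[R] ↥I := Submodule.inclusion inf_le_left
    have hρ0 : ∀ a : ↥I, ρ a = 0 ↔ (a : R) ∈ Jn := fun a => by
      rw [← Ideal.Quotient.eq_zero_iff_mem]
      constructor
      · intro h0
        exact congrArg Subtype.val h0
      · intro h0
        exact Subtype.ext h0
    have hιρ : Function.Exact ι ρ := by
      intro a
      rw [hρ0]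
      constructor
      · intro h0
        exact ⟨⟨(a : R), a.2, h0⟩, rfl⟩
      · rintro ⟨l, rfl⟩
        exact l.2.2
    have hρ : Function.Surjective ρ := by
      rintro ⟨z, hz⟩
      obtain ⟨a, ha, rfl⟩ :=
        (Ideal.mem_map_iff_of_surjective (Ideal.Quotient.mk Jn) Ideal.Quotient.mk_surjective).mp hz
      exact ⟨⟨a, ha⟩, rfl⟩
    -- `N ⊗ Ī → N ⊗ A/Jⁿ` is injective: its cokernel is finite and killed by `Jⁿ`
    have hinj : Function.Injective (LinearMap.lTensor N Ibar.subtype) := by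
      have hT : TorOneVanishes R N ((R ⧸ Jn) ⧸ Ibar) := by
        refine torOneVanishes_of_pow_smul_eq_zero hJfg hi hii (k + c) ((R ⧸ Jn) ⧸ Ibar) ?_
        intro j hj q
        obtain ⟨q, rfl⟩ := Ibar.mkQ_surjective q
        obtain ⟨r, rfl⟩ := Ideal.Quotient.mk_surjective q
        have hjr : j • (Ideal.Quotient.mk Jn r) = 0 := by
          rw [Algebra.smul_def, Ideal.Quotient.algebraMap_eq, ← map_mul,
            Ideal.Quotient.eq_zero_iff_mem]
          exact Jn.mul_mem_right r hj
        rw [← map_smul, hjr, map_zero]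
      exact hT.lTensor_injective (f := Ibar.subtype) (g := Ibar.mkQ)
        (LinearMap.exact_subtype_mkQ Ibar) (Submodule.injective_subtype _)
        (Submodule.mkQ_surjective Ibar)
    -- chase: `x ↦ 0` in `N ⊗ Ī`, so `x` comes from `N ⊗ (I ∩ Jⁿ)`
    have hcomm : Ibar.subtype ∘ₗ ρ = mk ∘ₗ I.subtype := rfl
    have h1 : LinearMap.lTensor N Ibar.subtype (LinearMap.lTensor N ρ x) = 0 := by
      rw [← LinearMap.comp_apply, ← LinearMap.lTensor_comp, hcomm, LinearMap.lTensor_comp,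
        LinearMap.comp_apply, hx, map_zero]
    have h2 : LinearMap.lTensor N ρ x = 0 := hinj (by rw [h1, map_zero])
    obtain ⟨y, hy⟩ := ((lTensor_exact N hιρ hρ) x).mp h2
    -- Artin–Rees: the image of `N ⊗ (I ∩ Jⁿ)` lies in `Jᵏ (N ⊗ I)`
    have hrange : ∀ y, LinearMap.lTensor N ι y ∈ (J ^ k • ⊤ : Submodule R (N ⊗[R] ↥I)) := by
      intro y
      induction y using TensorProduct.induction_on with
      | zero => rw [map_zero]; exact Submodule.zero_mem _
      | add y z hy hz => rw [map_add]; exact Submodule.add_mem _ hy hz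
      | tmul m l =>
        rw [LinearMap.lTensor_tmul]
        have hl : ι l ∈ (J ^ k • ⊤ : Submodule R ↥I) := by
          rw [Submodule.mem_smul_top_iff]
          exact hAR k l l.2.1 l.2.2
        have hT : (TensorProduct.mk R N ↥I m) (ι l) ∈
            Submodule.map (TensorProduct.mk R N ↥I m) (J ^ k • ⊤) := Submodule.mem_map_of_mem hl
        rw [Submodule.map_smul''] at hT
        exact Submodule.smul_mono le_rfl le_top hT
    rw [← hy]
    exact hrange y
  -- conclude by separatedness
  have hx0 : x ∈ (⨅ k : ℕ, J ^ k • ⊤ : Submodule R (N ⊗[R] ↥I)) :=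
    (Submodule.mem_iInf _).mpr hmem
  rwa [hsep I, Submodule.mem_bot] at hx0

/-! ### Finite modules over a Noetherian algebra `B` with `JB ⊆ rad B` -/

/-- `N ⊗_A Q` is a finite `B`-module when `N` is a finite `B`-module and `Q` a finite `A`-module
(`B` an `A`-algebra acting on the left factor): a quotient of `N ⊗_A Aⁿ ≅ Nⁿ`. [folklore] -/
theorem finite_tensorProduct_of_finite {B : Type w} [CommRing B] [Algebra R B] [Module B N]
    [IsScalarTower R B N] [Module.Finite B N] (Q : Type*) [AddCommGroup Q] [Module R Q]
    [Module.Finite R Q] : Module.Finite B (N ⊗[R] Q) := by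
  classical
  obtain ⟨n, π, hπ⟩ := Module.Finite.exists_fin' R Q
  let e : N ⊗[R] (Fin n → R) ≃ₗ[B] (Fin n → N) := TensorProduct.piScalarRight R B N (Fin n)
  let f : (Fin n → N) →ₗ[B] N ⊗[R] Q :=
    (TensorProduct.AlgebraTensorModule.lTensor B N π) ∘ₗ e.symm.toLinearMap
  refine Module.Finite.of_surjective f fun t => ?_
  obtain ⟨s, rfl⟩ := LinearMap.lTensor_surjective N hπ t
  exact ⟨e s, by simp [f]⟩

/-- **Matsumura, Thm. 22.3 (β), (3) ⇒ (1)** for finite modules over a Noetherian algebra: let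
`A` be Noetherian, `B` a Noetherian `A`-algebra, `J` an ideal of `A` with `JB ⊆ rad(B)`, and `N`
a finite `B`-module. If `N ⊗ J → N ⊗ A` is injective (`Tor₁^A(A/J, N) = 0`) and `N/JN` is flat
over `A/J`, then `N` is flat over `A` — `N` is `J`-adically ideal-separated by Krull's intersection
theorem in the finite `B`-modules `N ⊗_A 𝔞` (the remark before Thm. 22.3), and
`flat_of_iInf_pow_smul_eq_bot` applies.
[cite: Matsumura1987, §22 Thm. 22.3 (β) with the remark preceding it] -/
theorem flat_of_le_jacobson [IsNoetherianRing R] {B : Type w} [CommRing B] [Algebra R B]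
    [IsNoetherianRing B] [Module B N] [IsScalarTower R B N] [Module.Finite B N] (J : Ideal R)
    (hJ : J.map (algebraMap R B) ≤ (⊥ : Ideal B).jacobson)
    (hi : Function.Injective (LinearMap.lTensor N J.subtype))
    (hii : ∀ 𝔠' : Ideal (R ⧸ J),
      Function.Injective (LinearMap.lTensor N (𝔠'.subtype.restrictScalars R))) :
    Module.Flat R N := by
  refine flat_of_iInf_pow_smul_eq_bot J (fun I => ?_) hi hii
  haveI : Module.Finite B (N ⊗[R] ↥I) := finite_tensorProduct_of_finite (R := R) (N := N) (B := B) ↥I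
  have hK := Ideal.iInf_pow_smul_eq_bot_of_le_jacobson (J.map (algebraMap R B))
    (M := N ⊗[R] ↥I) hJ
  rw [eq_bot_iff]
  intro x hx
  have hx' : x ∈ (⨅ i : ℕ, (J.map (algebraMap R B)) ^ i • ⊤ : Submodule B (N ⊗[R] ↥I)) := by
    rw [Submodule.mem_iInf] at hx ⊢
    intro i
    have hle : (J ^ i • ⊤ : Submodule R (N ⊗[R] ↥I)) ≤
        ((J.map (algebraMap R B)) ^ i • ⊤ : Submodule B (N ⊗[R] ↥I)).restrictScalars R := by
      refine Submodule.smul_le.mpr fun j hj t _ => ?_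
      change j • t ∈ ((J.map (algebraMap R B)) ^ i • ⊤ : Submodule B (N ⊗[R] ↥I))
      rw [← algebraMap_smul B j t]
      refine Submodule.smul_mem_smul ?_ Submodule.mem_top
      rw [← Ideal.map_pow]
      exact Ideal.mem_map_of_mem _ hj
    exact hle (hx i)
  rw [hK] at hx'
  exact hx'

/-! ### The local criterion (Stacks 00MK) -/

/-- **The local criterion for flatness** (The Stacks Project, Tag 00MK: "Let `R → S` be a local
homomorphism of local Noetherian rings. Let `𝔪` be the maximal ideal of `R`, and let `κ = R/𝔪`.
Let `M` be a finite `S`-module. If `Tor₁^R(κ, M) = 0`, then `M` is flat over `R`."; Matsumura,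
Thm. 22.3 (3′) ⇒ (1) with `I = 𝔪`), with `Tor₁^R(κ, M) = 0` in the form "`M ⊗ 𝔪 → M ⊗ R` is
injective" (The Stacks Project, Remark 00M6): `𝔪S ⊆ 𝔪_S = rad S` for a local homomorphism, and
every module over the field `κ` is flat. [cite: StacksProject, Tag 00MK] -/
theorem flat_of_injective_lTensor_maximalIdeal {A : Type u} [CommRing A] [IsNoetherianRing A]
    [IsLocalRing A] {B : Type w} [CommRing B] [IsNoetherianRing B] [IsLocalRing B] [Algebra A B]
    [IsLocalHom (algebraMap A B)] {M : Type v} [AddCommGroup M] [Module A M] [Module B M]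
    [IsScalarTower A B M] [Module.Finite B M]
    (h : Function.Injective (LinearMap.lTensor M (IsLocalRing.maximalIdeal A).subtype)) :
    Module.Flat A M := by
  refine flat_of_le_jacobson (B := B) (IsLocalRing.maximalIdeal A) ?_ h fun 𝔠' => ?_
  · calc (IsLocalRing.maximalIdeal A).map (algebraMap A B) ≤ IsLocalRing.maximalIdeal B :=
          ((IsLocalRing.local_hom_TFAE (algebraMap A B)).out 0 2).mp ‹_›
      _ ≤ (⊥ : Ideal B).jacobson := IsLocalRing.maximalIdeal_le_jacobson ⊥
  · letI := Ideal.Quotient.field (IsLocalRing.maximalIdeal A)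
    haveI : Module.Flat (A ⧸ IsLocalRing.maximalIdeal A)
        ((A ⧸ IsLocalRing.maximalIdeal A) ⊗[A] M) := inferInstance
    exact lTensor_injective_of_flat_baseChange (S := A ⧸ IsLocalRing.maximalIdeal A) 𝔠'

end Literature.RingTheory.Flat
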